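import Literature.Geometry.Lorentzian.KerrDataSchwarzschildExtrinsic
import Mathlib.Analysis.SpecialFunctions.Log.Deriv
import HarnessLib

/-!
# Crux `SwallowTheDatum.UniversalWitnessFamily` (stmt-FinalStateConjecture-10051), line `Sketch`
# (throat-settles-too), stub `stub_sheetDataEmbedding` — support part 1: calculus of the static
# slice map

Support file (everything proved, no definitions; continued in
`SwallowTheDatumUniversalWitnessFamilyStubSheetDataEmbeddingAlgebra.lean`) for the stub
`stub_sheetDataEmbedding` (`SwallowTheDatumUniversalWitnessFamilyStubSheetDataEmbedding.lean`):
the STATIC SLICE MAP of the open sheet `{‖y‖ > M/2}` of the time-symmetric isotropic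
Schwarzschild end into the Kerr–Schild (ingoing Eddington–Finkelstein) Schwarzschild exterior
`{r > 2M} ⊂ E4`, `g = η + (2M/r) ℓ ⊗ ℓ`, `ℓ = (1, x⃗/r)` (`Kerr.bilin M 0`),

  `Φ(y) = (T, x⃗) = (2M log(r/2M − 1), (1 + M/2ρ)² y)`,  `ρ = ‖y‖`,  `r = ρ (1 + M/2ρ)²`

(the slice `{t = 0}` of static time `t = t* − 2M log(r/2M − 1)` over the isotropic chart
`x⃗ = (1 + M/2ρ)² y`; Misner–Thorne–Wheeler 1973, (31.22) and §31.7; Wald 1984, §6.4), and the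
field `N(y) = (1 − 2M/r)^{-1/2} ∂_{t*}` along it.

This part: the one-variable profile functions `φ(ρ) = 1 + M/2ρ`, `r(ρ) = ρ φ²`,
`T(ρ) = 2M log(r/2M − 1)` and their derivatives (`hasDerivAt_height`:
`T′ = 2M r′/(r − 2M) = 2M (2ρ + M)/(ρ (2ρ − M))`, using `r − 2M = ρ (1 − M/2ρ)²`), the
smoothness of `Φ` and `N` on the sheet, and the closed-form differential of `Φ`
(`hasFDerivAt_sheet`, `fderiv_sheet_apply`):
`dΦ_y v = (T′(ρ) ⟪y,v⟫/ρ, (1 + M/2ρ)² v − (M (1 + M/2ρ)/ρ³) ⟪y,v⟫ y)`.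

References: C. W. Misner, K. S. Thorne, J. A. Wheeler, *Gravitation* (1973), §31.7, (31.22);
R. M. Wald, *General Relativity* (1984), §6.4; M. Dafermos, I. Rodnianski, arXiv:0811.0354, §5.1.
-/

set_option linter.dupNamespace false

noncomputable section

namespace Summit.FinalStateConjecture.FinalStateConjecture.Theorems.SwallowTheDatum.UniversalWitnessFamily

open scoped Manifold ContDiff Topology InnerProductSpace
open Set Function Literature.Geometry.Lorentzian

/-! ### One-variable calculus of the isotropic profile functions -/

section Profile

/-- The isotropic conformal factor `φ(ρ) = 1 + M/(2ρ)` has derivative `−M/(2ρ²)` for `ρ ≠ 0`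
(MTW 1973, (31.22)). -/
theorem hasDerivAt_phi (M : ℝ) {ρ : ℝ} (hρ : ρ ≠ 0) :
    HasDerivAt (fun ρ : ℝ ↦ 1 + M / (2 * ρ)) (-(M / (2 * ρ ^ 2))) ρ := by
  have h2 : (2 : ℝ) * ρ ≠ 0 := mul_ne_zero two_ne_zero hρ
  refine (((hasDerivAt_const ρ M).fun_div ((hasDerivAt_id' ρ).const_mul 2) h2).const_add
    1).congr_deriv ?_
  field_simp
  ring

/-- The areal radius `r(ρ) = ρ (1 + M/(2ρ))²` of the isotropic chart has derivative
`r′ = (1 + M/(2ρ))(1 − M/(2ρ))` (MTW 1973, (31.22)). -/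
theorem hasDerivAt_areal (M : ℝ) {ρ : ℝ} (hρ : ρ ≠ 0) :
    HasDerivAt (fun ρ : ℝ ↦ ρ * (1 + M / (2 * ρ)) ^ 2)
      ((1 + M / (2 * ρ)) * (1 - M / (2 * ρ))) ρ := by
  refine ((hasDerivAt_id' ρ).mul ((hasDerivAt_phi M hρ).pow 2)).congr_deriv ?_
  norm_num
  field_simp
  ring

/-- `r − 2M = ρ (1 − M/(2ρ))²`: the areal radius exceeds `2M` off the throat `ρ = M/2`
(MTW 1973, §31.7). -/
theorem areal_sub_two_mul (M : ℝ) {ρ : ℝ} (hρ : ρ ≠ 0) :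
    ρ * (1 + M / (2 * ρ)) ^ 2 - 2 * M = ρ * (1 - M / (2 * ρ)) ^ 2 := by
  field_simp
  ring

/-- The static height `T(ρ) = 2M log(r(ρ)/2M − 1)` has derivative
`T′(ρ) = 2M r′/(r − 2M) = 2M (2ρ + M)/(ρ (2ρ − M))` for `ρ ≠ 0`, `2ρ ≠ M`, `M ≠ 0`
(Wald 1984, §6.4: `dt* = dt + 2M dr/(r − 2M)`). -/
theorem hasDerivAt_height {M ρ : ℝ} (hM : M ≠ 0) (hρ : ρ ≠ 0) (hk : 2 * ρ - M ≠ 0) :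
    HasDerivAt (fun ρ : ℝ ↦ 2 * M * Real.log (ρ * (1 + M / (2 * ρ)) ^ 2 / (2 * M) - 1))
      (2 * M * (2 * ρ + M) / (ρ * (2 * ρ - M))) ρ := by
  have h2M : (2 : ℝ) * M ≠ 0 := mul_ne_zero two_ne_zero hM
  have hk' : 1 - M / (2 * ρ) ≠ 0 := by
    rw [one_sub_div (mul_ne_zero two_ne_zero hρ)]
    exact div_ne_zero hk (mul_ne_zero two_ne_zero hρ)
  have hne : ρ * (1 + M / (2 * ρ)) ^ 2 / (2 * M) - 1 ≠ 0 := by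
    rw [div_sub_one h2M, areal_sub_two_mul M hρ]
    exact div_ne_zero (mul_ne_zero hρ (pow_ne_zero 2 hk')) h2M
  refine (((((hasDerivAt_areal M hρ).div_const (2 * M)).sub_const 1).log hne).const_mul
    (2 * M)).congr_deriv ?_
  rw [div_sub_one h2M, areal_sub_two_mul M hρ]
  field_simp

end Profile

/-! ### The slice map and the normal on `E3`: smoothness and the differential -/

section Representatives

variable {M : ℝ}

/-- `y ↦ ‖y‖ (1 + M/(2‖y‖))²` (the areal radius) is `C^n` away from the origin. -/
theorem contDiffAt_areal_E3 (M : ℝ) {y : E3} (hy : y ≠ 0) {n : WithTop ℕ∞} :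
    ContDiffAt ℝ n (fun y : E3 ↦ ‖y‖ * (1 + M / (2 * ‖y‖)) ^ 2) y := by
  have hn : ContDiffAt ℝ n (fun y : E3 ↦ ‖y‖) y := contDiffAt_norm ℝ hy
  have h2 : (2 : ℝ) * ‖y‖ ≠ 0 := mul_ne_zero two_ne_zero (norm_ne_zero_iff.2 hy)
  exact hn.mul ((contDiffAt_const.add (contDiffAt_const.div (contDiffAt_const.mul hn) h2)).pow 2)

/-- The static height `y ↦ 2M log(r/2M − 1)` is `C^n` at `y ≠ 0` with `2‖y‖ ≠ M` (`M ≠ 0`). -/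
theorem contDiffAt_height_E3 {M : ℝ} (hM : M ≠ 0) {y : E3} (hy : y ≠ 0) (hk : 2 * ‖y‖ - M ≠ 0)
    {n : WithTop ℕ∞} :
    ContDiffAt ℝ n
      (fun y : E3 ↦ 2 * M * Real.log (‖y‖ * (1 + M / (2 * ‖y‖)) ^ 2 / (2 * M) - 1)) y := by
  have h2M : (2 : ℝ) * M ≠ 0 := mul_ne_zero two_ne_zero hM
  have hρ : ‖y‖ ≠ 0 := norm_ne_zero_iff.2 hy
  have hk' : 1 - M / (2 * ‖y‖) ≠ 0 := by
    rw [one_sub_div (mul_ne_zero two_ne_zero hρ)]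
    exact div_ne_zero hk (mul_ne_zero two_ne_zero hρ)
  have hne : ‖y‖ * (1 + M / (2 * ‖y‖)) ^ 2 / (2 * M) - 1 ≠ 0 := by
    rw [div_sub_one h2M, areal_sub_two_mul M hρ]
    exact div_ne_zero (mul_ne_zero hρ (pow_ne_zero 2 hk')) h2M
  exact contDiffAt_const.mul ((((contDiffAt_areal_E3 M hy).div_const (2 * M)).sub
    contDiffAt_const).log hne)

/-- The lapse `y ↦ (1 − 2M/r)^{-1/2}` is `C^n` at `y ≠ 0` with `2‖y‖ + M ≠ 0` wherever
`1 − 2M/r > 0`. -/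
theorem contDiffAt_lapse_E3 {M : ℝ} {y : E3} (hy : y ≠ 0) (hφ : 2 * ‖y‖ + M ≠ 0)
    (hpos : 0 < 1 - 2 * M / (‖y‖ * (1 + M / (2 * ‖y‖)) ^ 2)) {n : WithTop ℕ∞} :
    ContDiffAt ℝ n
      (fun y : E3 ↦ (Real.sqrt (1 - 2 * M / (‖y‖ * (1 + M / (2 * ‖y‖)) ^ 2)))⁻¹) y := by
  have hρ : ‖y‖ ≠ 0 := norm_ne_zero_iff.2 hy
  have h2 : (2 : ℝ) * ‖y‖ ≠ 0 := mul_ne_zero two_ne_zero hρ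
  have hφ' : 1 + M / (2 * ‖y‖) ≠ 0 := by
    rw [one_add_div h2]
    exact div_ne_zero hφ h2
  have hr0 : ‖y‖ * (1 + M / (2 * ‖y‖)) ^ 2 ≠ 0 := mul_ne_zero hρ (pow_ne_zero 2 hφ')
  have h1 : ContDiffAt ℝ n (fun y : E3 ↦ 1 - 2 * M / (‖y‖ * (1 + M / (2 * ‖y‖)) ^ 2)) y :=
    contDiffAt_const.sub (contDiffAt_const.div (contDiffAt_areal_E3 M hy) hr0)
  exact (h1.sqrt hpos.ne').inv (Real.sqrt_pos.2 hpos).ne'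

/-- Chain rule through the norm: if `F` has derivative `F′` at `‖y‖`, `y ≠ 0`, then
`y ↦ F ‖y‖` has differential `(F′/‖y‖) ⟪y, ·⟫`. -/
theorem hasFDerivAt_comp_norm {F : ℝ → ℝ} {F' : ℝ} {y : E3} (hy : y ≠ 0)
    (hF : HasDerivAt F F' ‖y‖) :
    HasFDerivAt (fun y : E3 ↦ F ‖y‖) ((F' * ‖y‖⁻¹) • E3.covec y) y := by
  have h := hF.comp_hasFDerivAt y (Kerr.hasFDerivAt_norm_E3 hy)
  rw [smul_smul] at h
  exact h

/-- The isotropic space map `y ↦ (1 + M/(2ρ))² y` has differential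
`v ↦ (1 + M/(2ρ))² v − (M (1 + M/(2ρ))/ρ³) ⟪y, v⟫ y` at `y ≠ 0`. -/
theorem hasFDerivAt_spaceMap (M : ℝ) {y : E3} (hy : y ≠ 0) :
    HasFDerivAt (fun y : E3 ↦ (1 + M / (2 * ‖y‖)) ^ 2 • y)
      ((1 + M / (2 * ‖y‖)) ^ 2 • ContinuousLinearMap.id ℝ E3 +
        ((-(M * (1 + M / (2 * ‖y‖)) / ‖y‖ ^ 3)) • E3.covec y).smulRight y) y := by
  have hρ : ‖y‖ ≠ 0 := norm_ne_zero_iff.2 hy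
  have h := (hasFDerivAt_comp_norm hy ((hasDerivAt_phi M hρ).pow 2)).smul (hasFDerivAt_id y)
  refine h.congr_fderiv ?_
  have hc : (((2 : ℕ) : ℝ) * (1 + M / (2 * ‖y‖)) ^ (2 - 1) * -(M / (2 * ‖y‖ ^ 2))) * ‖y‖⁻¹ =
      -(M * (1 + M / (2 * ‖y‖)) / ‖y‖ ^ 3) := by
    norm_num
    field_simp
  rw [hc]
  rfl

/-- `(t, x) = t ∂_{t*} + (0, x)` in `E4`. -/
theorem ofTimeSpace_eq_smul_add (t : ℝ) (x : E3) :
    E4.ofTimeSpace t x = t • E4.basisVector 0 + Kerr.sliceEmbedCLM x := by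
  rw [Kerr.sliceEmbedCLM_apply]
  ext i
  refine Fin.cases ?_ (fun j ↦ ?_) i
  · simp
  · simp [Fin.succ_ne_zero]

/-- **The static slice map `Φ(y) = (2M log(r/2M − 1), (1 + M/2ρ)² y)` is differentiable on the
sheet** (`y ≠ 0`, `2‖y‖ ≠ M`, `M ≠ 0`), with differential
`dΦ_y = ((T′/ρ) ⟪y, ·⟫) ∂_{t*} + (0, (1 + M/2ρ)² · − (M (1 + M/2ρ)/ρ³) ⟪y, ·⟫ y)`,
`T′ = 2M (2ρ + M)/(ρ (2ρ − M))` (MTW 1973, §31.7; Wald 1984, §6.4). -/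
theorem hasFDerivAt_sheet {M : ℝ} (hM : M ≠ 0) {y : E3} (hy : y ≠ 0) (hk : 2 * ‖y‖ - M ≠ 0) :
    HasFDerivAt (fun y : E3 ↦ E4.ofTimeSpace
        (2 * M * Real.log (‖y‖ * (1 + M / (2 * ‖y‖)) ^ 2 / (2 * M) - 1))
        ((1 + M / (2 * ‖y‖)) ^ 2 • y))
      (((2 * M * (2 * ‖y‖ + M) / (‖y‖ * (2 * ‖y‖ - M)) * ‖y‖⁻¹) • E3.covec y).smulRight
          (E4.basisVector 0) +
        Kerr.sliceEmbedCLM.comp ((1 + M / (2 * ‖y‖)) ^ 2 • ContinuousLinearMap.id ℝ E3 +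
          ((-(M * (1 + M / (2 * ‖y‖)) / ‖y‖ ^ 3)) • E3.covec y).smulRight y)) y := by
  have hfun : (fun y : E3 ↦ E4.ofTimeSpace
      (2 * M * Real.log (‖y‖ * (1 + M / (2 * ‖y‖)) ^ 2 / (2 * M) - 1))
      ((1 + M / (2 * ‖y‖)) ^ 2 • y)) = fun y : E3 ↦
      (2 * M * Real.log (‖y‖ * (1 + M / (2 * ‖y‖)) ^ 2 / (2 * M) - 1)) • E4.basisVector 0 +
        Kerr.sliceEmbedCLM ((1 + M / (2 * ‖y‖)) ^ 2 • y) :=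
    funext fun y ↦ ofTimeSpace_eq_smul_add _ _
  rw [hfun]
  exact ((hasFDerivAt_comp_norm hy (hasDerivAt_height hM (norm_ne_zero_iff.2 hy) hk)).smul_const
    (E4.basisVector 0)).add (Kerr.sliceEmbedCLM.hasFDerivAt.comp y (hasFDerivAt_spaceMap M hy))

/-- **The differential of the static slice map, applied**:
`dΦ_y v = (T′ ⟪y,v⟫/ρ, (1 + M/(2ρ))² v − (M (1 + M/(2ρ))/ρ³) ⟪y,v⟫ y)`,
`T′ = 2M (2ρ + M)/(ρ (2ρ − M))`. -/
theorem fderiv_sheet_apply {M : ℝ} (hM : M ≠ 0) {y : E3} (hy : y ≠ 0) (hk : 2 * ‖y‖ - M ≠ 0)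
    (v : E3) :
    fderiv ℝ (fun y : E3 ↦ E4.ofTimeSpace
        (2 * M * Real.log (‖y‖ * (1 + M / (2 * ‖y‖)) ^ 2 / (2 * M) - 1))
        ((1 + M / (2 * ‖y‖)) ^ 2 • y)) y v =
      E4.ofTimeSpace (2 * M * (2 * ‖y‖ + M) / (‖y‖ * (2 * ‖y‖ - M)) * ‖y‖⁻¹ * ⟪y, v⟫_ℝ)
        ((1 + M / (2 * ‖y‖)) ^ 2 • v + ((-(M * (1 + M / (2 * ‖y‖)) / ‖y‖ ^ 3)) * ⟪y, v⟫_ℝ) • y) := by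
  rw [(hasFDerivAt_sheet hM hy hk).fderiv, ofTimeSpace_eq_smul_add]
  simp only [add_apply, ContinuousLinearMap.comp_apply, ContinuousLinearMap.smulRight_apply,
    FunLike.coe_smul, Pi.smul_apply, E3.covec_apply, ContinuousLinearMap.coe_id',
    id_eq, smul_eq_mul]

/-- The static slice map is `C^n` on the sheet (`y ≠ 0`, `2‖y‖ ≠ M`, `M ≠ 0`). -/
theorem contDiffAt_sheet {M : ℝ} (hM : M ≠ 0) {y : E3} (hy : y ≠ 0) (hk : 2 * ‖y‖ - M ≠ 0)
    {n : WithTop ℕ∞} :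
    ContDiffAt ℝ n (fun y : E3 ↦ E4.ofTimeSpace
        (2 * M * Real.log (‖y‖ * (1 + M / (2 * ‖y‖)) ^ 2 / (2 * M) - 1))
        ((1 + M / (2 * ‖y‖)) ^ 2 • y)) y := by
  have hfun : (fun y : E3 ↦ E4.ofTimeSpace
      (2 * M * Real.log (‖y‖ * (1 + M / (2 * ‖y‖)) ^ 2 / (2 * M) - 1))
      ((1 + M / (2 * ‖y‖)) ^ 2 • y)) = fun y : E3 ↦
      (2 * M * Real.log (‖y‖ * (1 + M / (2 * ‖y‖)) ^ 2 / (2 * M) - 1)) • E4.basisVector 0 +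
        Kerr.sliceEmbedCLM ((1 + M / (2 * ‖y‖)) ^ 2 • y) :=
    funext fun y ↦ ofTimeSpace_eq_smul_add _ _
  have hn : ContDiffAt ℝ n (fun y : E3 ↦ ‖y‖) y := contDiffAt_norm ℝ hy
  have h2 : (2 : ℝ) * ‖y‖ ≠ 0 := mul_ne_zero two_ne_zero (norm_ne_zero_iff.2 hy)
  have hφ : ContDiffAt ℝ n (fun y : E3 ↦ (1 + M / (2 * ‖y‖)) ^ 2) y :=
    (contDiffAt_const.add (contDiffAt_const.div (contDiffAt_const.mul hn) h2)).pow 2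
  rw [hfun]
  exact ((contDiffAt_height_E3 hM hy hk).smul contDiffAt_const).add
    (Kerr.sliceEmbedCLM.contDiff.contDiffAt.comp y (hφ.smul contDiffAt_id))

/-- The normal `N(y) = (1 − 2M/r)^{-1/2} ∂_{t*}` is differentiable on the sheet. -/
theorem differentiableAt_normal {M : ℝ} {y : E3} (hy : y ≠ 0) (hφ : 2 * ‖y‖ + M ≠ 0)
    (hpos : 0 < 1 - 2 * M / (‖y‖ * (1 + M / (2 * ‖y‖)) ^ 2)) :
    DifferentiableAt ℝ (fun y : E3 ↦
      (Real.sqrt (1 - 2 * M / (‖y‖ * (1 + M / (2 * ‖y‖)) ^ 2)))⁻¹ • E4.basisVector 0) y :=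
  ((contDiffAt_lapse_E3 hy hφ hpos (n := 1)).differentiableAt one_ne_zero).smul_const _

/-- The differential of the normal `N = lapse • ∂_{t*}` is everywhere a multiple of the constant
vector `∂_{t*}`. -/
theorem fderiv_normal_apply {M : ℝ} {y : E3} (hy : y ≠ 0) (hφ : 2 * ‖y‖ + M ≠ 0)
    (hpos : 0 < 1 - 2 * M / (‖y‖ * (1 + M / (2 * ‖y‖)) ^ 2)) (v : E3) :
    ∃ c : ℝ, fderiv ℝ (fun y : E3 ↦
      (Real.sqrt (1 - 2 * M / (‖y‖ * (1 + M / (2 * ‖y‖)) ^ 2)))⁻¹ • E4.basisVector 0) y v =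
        c • E4.basisVector 0 := by
  refine ⟨fderiv ℝ (fun y : E3 ↦ (Real.sqrt (1 - 2 * M / (‖y‖ * (1 + M / (2 * ‖y‖)) ^ 2)))⁻¹) y v,
    ?_⟩
  rw [fderiv_smul_const ((contDiffAt_lapse_E3 hy hφ hpos (n := 1)).differentiableAt one_ne_zero)]
  rfl

end Representatives

/-! ### Registered anchor of this support file -/

/-- **Registered sub-goal `sheetDataEmbedding_heightSlope` of stub `stub_sheetDataEmbedding`**
(the anchor by which this support file serves item stmt-FinalStateConjecture-10051): the slope of
the static height, `T′(ρ) = 2M (2ρ + M)/(ρ (2ρ − M))` for `T(ρ) = 2M log(ρ (1 + M/2ρ)²/2M − 1)`,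
`M ≠ 0`, `ρ ≠ 0`, `2ρ ≠ M` (`hasDerivAt_height`; Wald 1984, §6.4). -/
theorem sheetDataEmbedding_heightSlope : ∀ (M ρ : ℝ), M ≠ 0 → ρ ≠ 0 → 2 * ρ - M ≠ 0 → HasDerivAt (fun ρ : ℝ ↦ 2 * M * Real.log (ρ * (1 + M / (2 * ρ)) ^ 2 / (2 * M) - 1)) (2 * M * (2 * ρ + M) / (ρ * (2 * ρ - M))) ρ :=
  fun _ _ hM hρ hk ↦ hasDerivAt_height hM hρ hk

end Summit.FinalStateConjecture.FinalStateConjecture.Theorems.SwallowTheDatum.UniversalWitnessFamily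

end
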